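import Summits.NavierStokesRegularity.NavierStokesRegularity.Theses.FilamentSkeletonRss
import Literature.Analysis.FluidPDE.AncientMildDrift

/-!
# Disproof of `RdssProfileTruncation` (stmt-NavierStokesRegularity-11289) — findings

Work file of the crux disprover (cdisprove seat `refuter-cdisprove-stmt-NavierStokesRegularity-11289-0`,
cycle 1, 2026-08-16).  Prose only in docstrings.  Crux #4 of route `FilamentSkeletonRss`, shared
verbatim with `CorkscrewDynamo` #3 (and ≡ stmt-0901 `DssTruncationBridge`, ≡ stmt-10475, by the
one-shot refuters' equivalence files on the item).

* **Structure (§0).** `RdssProfileTruncation` is the material implication `RdssWitness → X5a`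
  (`crux_iff`, `Iff.rfl`) between two CLOSED propositions: the antecedent says "a nontrivial Type-I
  rotated-DSS ancient mild solution exists" (= ¬ Bradshaw–Tsai Open Problem 5.1 / Tsai Conj. 8.8–8.9,
  OPEN), the conclusion `X5a` says "some rapidly decaying divergence-free datum has a Leray–Hopf
  classical solution of finite maximal lifespan" (finite-time blow-up, OPEN).  Hence
  `¬ crux ↔ RdssWitness ∧ ¬ X5a` (`not_crux_iff`): an unconditional kill needs a Type-I RDSS blow-up
  PROFILE **and** a no-blow-up theorem for ALL rapidly decaying data (Clay (A) territory).  This is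
  WHY the crux resists; conversely it is implied by `X5a` alone (`crux_of_x5a`) and by the Liouville
  theorem for Type-I RDSS ancient mild solutions alone (`crux_of_liouville`, the vacuous direction;
  Chae–Wolf 2017 Thm 1.3 gives it for `R = 1` and `1 < c < λ_*(C₀)` only).
* **Load-bearing analysis (§a).**  For each hypothesis `H` of the antecedent the weakened crux
  `CruxWithout<H>` is defined and shown to COLLAPSE to `X5a` (`… ↔ X5a`) by an explicit inhabitant of
  the weakened antecedent — the form "`¬ CruxWithout<H>`" is out of reach for the same reason as the
  crux (it would need `¬ X5a`), so "collapse to the open blow-up problem" is the checked content of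
  "any proof must use `H`":
  - nontriviality: `u ≡ 0` (`withoutNontrivial_inhabited`, `cruxWithoutNontrivial_iff_x5a`);
  - the PDE (`IsAncientMildSolution`): the kinematic Type-I cone field `(‖x‖ + √(−t))⁻¹ e₀`
    (`withoutMild_inhabited`, `cruxWithoutMild_iff_x5a`);
  - the SPACE part of the Type-I bound: with `HasTypeIDecay` weakened to `HasTypeITimeDecay`
    (`‖u‖ ≤ C₀/√(−t)`) the antecedent is inhabited by KNSS's parasitic drift `(√(−t))⁻¹ e₀`
    (pressure `−½(−t)^{−3/2} x₁`), an honest member of the duality-form ancient mild class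
    (in-tree `isAncientMildSolution_timeConst`) which is (2,1)-RDSS, Type-I in time, nonzero, and
    NOT Type-I in space (`drift_not_hasTypeIDecay`): `cruxTimeDecayOnly_iff_x5a`,
    `cruxWithoutTypeI_iff_x5a`.  So any proof must use the spatial decay `C₀/(‖x‖ + √(−t))`, not
    only the blow-up rate;
  - the factor guard `1 < c`: `(1, refl)`-RDSS holds for EVERY field (`isRotatedDSS_one_refl`), so the
    guard-free crux is the STRONGER bridge "nontrivial Type-I ancient mild solution ⇒ blow-up"
    (`cruxWithoutFactorGuard_iff`), whose antecedent is the (open) failure of the Type-I ancient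
    Liouville theorem; `c ≤ −1`, `0 < |c| < 1` and `c = 0` add nothing (`isRotatedDSS_neg_iff`,
    `rdss_inv`, `isRotatedDSS_zero_iff`);
  - slice measurability: no inhabitant of the measurability-free antecedent is known or expected to
    be constructible here (Mathlib has no non-measurable set; a sign-pattern field
    `±(‖x‖+√(−t))⁻¹ e₀` over a scaling-invariant non-measurable set kills the linear pairings by
    Bochner junk but NOT the quadratic term, see §e) — recorded, not claimed.
* **Structure of witnesses (§b).**  Every antecedent witness has `0 < C₀` (`typeI_pos_of_witness`)
  and is UNBOUNDED on every parabolic neighbourhood `B_r × (−r², 0)` of the space-time origin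
  (`rdss_eq_zero_of_bdd_near_origin`: an `(c,R)`-RDSS field bounded near `(0,0)` vanishes on
  `t < 0`, by the inward iteration `u(t,x) = c⁻ⁿ Rⁿ u(t/c²ⁿ, c⁻ⁿR⁻ⁿx)`), i.e. it is a genuinely
  singular Type-I object, as the line `Sketch` (PICKED 2026-08-16) uses in its step (4).
  `(c,R)`-RDSS ⇒ `(c², R²)`-RDSS (`rdss_sq`): an improper `R` may be replaced by the proper
  `R²` at the cost of squaring the factor.
* **Targets (§d).**  None registered yet (payload.targets = [], stubs of `Lines/Sketch.lean` not on
  the ledger at this boundary).  Paper check of the card's first lemma `freePeriodMap_contracts`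
  (zoom-out gains `c^{−2κ}` on the weight `(1+|y|)^{1−2κ}`): TRUE by the three-regime estimate
  `|x| ≤ 1`, `1 ≤ |x| ≤ c`, `|x| ≥ c` — no attack.
* **Verdict (cycle 1): survives; not misstated.**  No junk inhabitant of the full antecedent (the
  Type-I space decay + measurable slices make every Bochner integral of the duality identity honest,
  in-tree `AncientMildDrift`), no refutation in print (Albritton–Barker 2019 Thm 1.1 is the LOCAL
  transfer only), conclusion not junk-provable (maximality + Leray–Hopf energy class exclude the
  parasitic `a(t)b` classical solutions).
-/

set_option linter.dupNamespace false

noncomputable section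

namespace Summit.NavierStokesRegularity.NavierStokesRegularity.Cruxes.RdssProfileTruncation.Disproof

open Summit.NavierStokesRegularity.NavierStokesRegularity.Theses.FilamentSkeletonRss
open Literature.Analysis.FluidPDE MeasureTheory

/-- Physical space. -/
local notation "ℝ³" => EuclideanSpace ℝ (Fin 3)

/-! ## §0 Structure of the crux -/

/-- The conclusion of the bridge: **X5a** (finite maximal lifespan of a Leray–Hopf classical solution
from a rapidly decaying datum), verbatim. [folklore] -/
def X5a : Prop :=
  ∃ ν : ℝ, 0 < ν ∧ ∃ T : ℝ, 0 < T ∧ ∃ (u : ℝ → ℝ³ → ℝ³) (p : ℝ → ℝ³ → ℝ),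
    IsMaximalSmoothSolution ν 0 u p T ∧ IsLerayHopfOn T ν 0 (u 0) u ∧ HasRapidSpatialDecay (u 0)

/-- The antecedent of the bridge: a nontrivial Type-I rotated-DSS ancient mild solution exists
(verbatim). [folklore] -/
def RdssWitness : Prop :=
  ∃ (c : ℝ) (R : ℝ³ ≃ₗᵢ[ℝ] ℝ³) (u : ℝ → ℝ³ → ℝ³), 1 < c ∧ IsAncientMildSolution 1 u ∧
    (∀ t < 0, AEStronglyMeasurable (u t) volume) ∧ IsRotatedDSS c R u ∧
    (∃ C₀ : ℝ, HasTypeIDecay C₀ u) ∧ ¬ (∀ t < 0, u t =ᵐ[volume] 0)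

/-- The crux is the implication `RdssWitness → X5a` (definitional). [folklore] -/
theorem crux_iff : RdssProfileTruncation ↔ (RdssWitness → X5a) := Iff.rfl

/-- **Why it resists.** A refutation is EXACTLY "a Type-I RDSS blow-up profile exists AND no rapidly
decaying datum ever blows up": both conjuncts are open problems. [folklore] -/
theorem not_crux_iff : ¬ RdssProfileTruncation ↔ (RdssWitness ∧ ¬ X5a) := by
  rw [crux_iff]; exact Classical.not_imp

/-- The crux follows from its conclusion alone. [folklore] -/
theorem crux_of_x5a (h : X5a) : RdssProfileTruncation := fun _ => h

/-- **Vacuous direction** (kill criterion (iii)/(iv) of the route): the crux follows from the Liouville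
theorem for Type-I rotated-DSS ancient mild solutions (Bradshaw–Tsai Open Problem 5.1 answered
positively; Chae–Wolf 2017 Thm 1.3 is the case `R = 1`, `1 < c < λ_*(C₀)`). [folklore] -/
theorem crux_of_liouville
    (hL : ∀ (c : ℝ) (R : ℝ³ ≃ₗᵢ[ℝ] ℝ³) (u : ℝ → ℝ³ → ℝ³), 1 < c → IsAncientMildSolution 1 u →
      (∀ t < 0, AEStronglyMeasurable (u t) volume) → IsRotatedDSS c R u →
      (∃ C₀ : ℝ, HasTypeIDecay C₀ u) → ∀ t < 0, u t =ᵐ[volume] 0) :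
    RdssProfileTruncation := by
  rintro ⟨c, R, u, hc, hm, hmeas, hdss, hC, hnz⟩
  exact absurd (hL c R u hc hm hmeas hdss hC) hnz

/-! ## §b Algebra of rotated discrete self-similarity and the shape of witnesses -/

section Algebra

variable {E : Type*} [NormedAddCommGroup E] [NormedSpace ℝ E]

/-- The identity isometry is its own inverse (definitional; no Mathlib simp lemma at this pin).
[folklore] -/
@[simp] theorem linearIsometryEquiv_refl_symm :
    (LinearIsometryEquiv.refl ℝ E).symm = LinearIsometryEquiv.refl ℝ E := rfl

/-- `(1, id)`-RDSS holds for EVERY field: the guard `1 < c` is what makes the symmetry non-void.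
[folklore] -/
theorem isRotatedDSS_one_refl (u : ℝ → E → E) : IsRotatedDSS 1 (LinearIsometryEquiv.refl ℝ E) u := by
  intro t x; simp

/-- Factor `0` forces the zero field (at all times). [folklore] -/
theorem isRotatedDSS_zero_iff (R : E ≃ₗᵢ[ℝ] E) (u : ℝ → E → E) :
    IsRotatedDSS 0 R u ↔ ∀ t x, u t x = 0 := by
  simp only [IsRotatedDSS, zero_smul]
  exact ⟨fun h t x => (h t x).symm, fun h t x => (h t x).symm⟩

/-- Negative factors are positive factors with the isometry composed with `−1 ∈ O(E)`:
`(−c, −R)`-RDSS ↔ `(c, R)`-RDSS. [folklore] -/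
theorem isRotatedDSS_neg_iff (c : ℝ) (R : E ≃ₗᵢ[ℝ] E) (u : ℝ → E → E) :
    IsRotatedDSS (-c) (R.trans (LinearIsometryEquiv.neg ℝ)) u ↔ IsRotatedDSS c R u := by
  simp only [IsRotatedDSS, LinearIsometryEquiv.trans_apply, LinearIsometryEquiv.coe_neg,
    LinearIsometryEquiv.symm_trans, LinearIsometryEquiv.symm_neg, neg_sq, smul_neg, neg_smul,
    neg_neg, map_neg]

/-- `(c, R)`-RDSS with `c ≠ 0` gives `(c⁻¹, R⁻¹)`-RDSS: factors in `(0,1)` are factors `> 1`.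
[folklore] -/
theorem rdss_inv {c : ℝ} {R : E ≃ₗᵢ[ℝ] E} {u : ℝ → E → E} (h : IsRotatedDSS c R u)
    (hc : c ≠ 0) : IsRotatedDSS c⁻¹ R.symm u := by
  intro t x
  have key := h (c⁻¹ ^ 2 * t) (c⁻¹ • R.symm x)
  have h1 : c ^ 2 * (c⁻¹ ^ 2 * t) = t := by field_simp
  have h2 : c • R (c⁻¹ • R.symm x) = x := by
    rw [map_smul, LinearIsometryEquiv.apply_symm_apply, smul_smul, mul_inv_cancel₀ hc, one_smul]
  rw [h1, h2] at key
  rw [LinearIsometryEquiv.symm_symm, ← key, map_smul, LinearIsometryEquiv.apply_symm_apply, smul_smul,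
    inv_mul_cancel₀ hc, one_smul]

/-- `(c, R)`-RDSS ⇒ `(c², R²)`-RDSS: an improper `R ∈ O(3)` may be traded for the proper `R²` at the
cost of squaring the factor. [folklore] -/
theorem rdss_sq {c : ℝ} {R : E ≃ₗᵢ[ℝ] E} {u : ℝ → E → E} (h : IsRotatedDSS c R u) :
    IsRotatedDSS (c ^ 2) (R.trans R) u := by
  intro t x
  have h1 := h t x
  have h2 := h (c ^ 2 * t) (c • R x)
  have e1 : (c ^ 2) ^ 2 * t = c ^ 2 * (c ^ 2 * t) := by ring
  have e2 : (c ^ 2) • (R.trans R) x = c • R (c • R x) := by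
    rw [LinearIsometryEquiv.trans_apply, map_smul, smul_smul, pow_two]
  rw [e1, e2, ← h1, ← h2]
  simp only [LinearIsometryEquiv.symm_trans, LinearIsometryEquiv.trans_apply, map_smul, smul_smul,
    pow_two]

/-- **Witnesses are genuinely singular at the space-time origin.** An `(c, R)`-RDSS field, `1 < c`,
which is bounded on some parabolic neighbourhood `‖x‖ < r`, `−r² < t < 0` of `(0, 0)` vanishes at
every point of `t < 0`: zooming in, `u(t,x) = c⁻ⁿ Rⁿ u(t/c²ⁿ, c⁻ⁿ R⁻ⁿ x)` with the argument
eventually inside the neighbourhood, so `‖u(t,x)‖ ≤ M c⁻ⁿ → 0`. [folklore] -/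
theorem rdss_eq_zero_of_bdd_near_origin {c : ℝ} {R : E ≃ₗᵢ[ℝ] E} {u : ℝ → E → E}
    (h : IsRotatedDSS c R u) (hc : 1 < c) {r M : ℝ} (hr : 0 < r)
    (hM : ∀ t x, -r ^ 2 < t → t < 0 → ‖x‖ < r → ‖u t x‖ ≤ M) :
    ∀ t < 0, ∀ x, u t x = 0 := by
  have hc0 : 0 < c := one_pos.trans hc
  have hcne : c ≠ 0 := hc0.ne'
  -- one inward step: `u t x = c⁻¹ • R (u (t / c²) (c⁻¹ • R⁻¹ x))`
  have step : ∀ t x, u t x = c⁻¹ • R (u (c⁻¹ ^ 2 * t) (c⁻¹ • R.symm x)) := by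
    intro t x
    have key := h (c⁻¹ ^ 2 * t) (c⁻¹ • R.symm x)
    have h1 : c ^ 2 * (c⁻¹ ^ 2 * t) = t := by field_simp
    have h2 : c • R (c⁻¹ • R.symm x) = x := by
      rw [map_smul, LinearIsometryEquiv.apply_symm_apply, smul_smul, mul_inv_cancel₀ hcne, one_smul]
    rw [h1, h2] at key
    rw [← key, map_smul, LinearIsometryEquiv.apply_symm_apply, smul_smul, inv_mul_cancel₀ hcne,
      one_smul]
  -- induction: on the dilated neighbourhoods the bound improves by `c⁻¹` per step
  have bound : ∀ n : ℕ, ∀ t x, -(r ^ 2 * (c ^ 2) ^ n) < t → t < 0 → ‖x‖ < r * c ^ n →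
      ‖u t x‖ ≤ M * c⁻¹ ^ n := by
    intro n
    induction n with
    | zero =>
      intro t x ht ht0 hx
      simpa using hM t x (by simpa using ht) ht0 (by simpa using hx)
    | succ n ih =>
      intro t x ht ht0 hx
      rw [step t x, norm_smul, Real.norm_of_nonneg (inv_nonneg.2 hc0.le), LinearIsometryEquiv.norm_map]
      have ht' : -(r ^ 2 * (c ^ 2) ^ n) < c⁻¹ ^ 2 * t := by
        have : c⁻¹ ^ 2 * (-(r ^ 2 * (c ^ 2) ^ (n + 1))) < c⁻¹ ^ 2 * t :=
          mul_lt_mul_of_pos_left ht (by positivity)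
        calc -(r ^ 2 * (c ^ 2) ^ n) = c⁻¹ ^ 2 * (-(r ^ 2 * (c ^ 2) ^ (n + 1))) := by
              field_simp; ring
          _ < c⁻¹ ^ 2 * t := this
      have ht0' : c⁻¹ ^ 2 * t < 0 := mul_neg_of_pos_of_neg (by positivity) ht0
      have hx' : ‖c⁻¹ • R.symm x‖ < r * c ^ n := by
        rw [norm_smul, Real.norm_of_nonneg (inv_nonneg.2 hc0.le), LinearIsometryEquiv.norm_map]
        calc c⁻¹ * ‖x‖ < c⁻¹ * (r * c ^ (n + 1)) := mul_lt_mul_of_pos_left hx (inv_pos.2 hc0)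
          _ = r * c ^ n := by field_simp; ring
      calc c⁻¹ * ‖u (c⁻¹ ^ 2 * t) (c⁻¹ • R.symm x)‖ ≤ c⁻¹ * (M * c⁻¹ ^ n) :=
            mul_le_mul_of_nonneg_left (ih _ _ ht' ht0' hx') (inv_nonneg.2 hc0.le)
        _ = M * c⁻¹ ^ (n + 1) := by ring
  -- conclusion: for fixed `(t, x)` the hypotheses of `bound n` hold for all large `n`
  intro t ht x
  have hcinv : c⁻¹ < 1 := inv_lt_one_of_one_lt₀ hc
  have hlim : Filter.Tendsto (fun n : ℕ => M * c⁻¹ ^ n) Filter.atTop (nhds 0) := by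
    simpa using (tendsto_pow_atTop_nhds_zero_of_lt_one (inv_nonneg.2 hc0.le) hcinv).const_mul M
  have hgrow : Filter.Tendsto (fun n : ℕ => r * c ^ n) Filter.atTop Filter.atTop :=
    (tendsto_pow_atTop_atTop_of_one_lt hc).const_mul_atTop hr
  have hgrow2 : Filter.Tendsto (fun n : ℕ => r ^ 2 * (c ^ 2) ^ n) Filter.atTop Filter.atTop :=
    (tendsto_pow_atTop_atTop_of_one_lt (by nlinarith)).const_mul_atTop (by positivity)
  have hev : ∀ᶠ n : ℕ in Filter.atTop, ‖u t x‖ ≤ M * c⁻¹ ^ n := by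
    filter_upwards [hgrow.eventually_gt_atTop ‖x‖, hgrow2.eventually_gt_atTop (-t)] with n hn hn2
    exact bound n t x (by linarith) ht hn
  have hle : ‖u t x‖ ≤ 0 := ge_of_tendsto hlim hev
  exact norm_le_zero_iff.1 hle

end Algebra

/-- The Type-I constant of a witness is positive: `C₀ ≤ 0` forces `u ≡ 0` on `t < 0`. [folklore] -/
theorem typeI_pos_of_witness {C₀ : ℝ} {u : ℝ → ℝ³ → ℝ³} (hC : HasTypeIDecay C₀ u)
    (hnz : ¬ (∀ t < 0, u t =ᵐ[volume] 0)) : 0 < C₀ := by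
  by_contra hle
  push Not at hle
  refine hnz fun t ht => Filter.Eventually.of_forall fun x => ?_
  have hden : 0 < ‖x‖ + Real.sqrt (-t) :=
    add_pos_of_nonneg_of_pos (norm_nonneg _) (Real.sqrt_pos.2 (by linarith))
  have h := hC t ht x
  have : C₀ / (‖x‖ + Real.sqrt (-t)) ≤ 0 := div_nonpos_of_nonpos_of_nonneg hle hden.le
  exact norm_le_zero_iff.1 (h.trans this)

/-- **Every witness is unbounded near the origin** (contrapositive of
`rdss_eq_zero_of_bdd_near_origin` inside the antecedent). [folklore] -/
theorem witness_unbounded_near_origin {c : ℝ} {R : ℝ³ ≃ₗᵢ[ℝ] ℝ³} {u : ℝ → ℝ³ → ℝ³} (hc : 1 < c)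
    (hdss : IsRotatedDSS c R u) (hnz : ¬ (∀ t < 0, u t =ᵐ[volume] 0)) {r : ℝ} (hr : 0 < r) (M : ℝ) :
    ∃ t x, -r ^ 2 < t ∧ t < 0 ∧ ‖x‖ < r ∧ M < ‖u t x‖ := by
  by_contra hcon
  push Not at hcon
  have hz := rdss_eq_zero_of_bdd_near_origin hdss hc hr hcon
  exact hnz fun t ht => Filter.Eventually.of_forall fun x => by simpa using hz t ht x

/-! ## §a Load-bearing hypotheses: each weakening collapses the bridge to `X5a` -/

/-! ### The three explicit fields -/

/-- The unit vector `e₀`. -/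
def e₀ : ℝ³ := EuclideanSpace.single 0 1

theorem norm_e₀ : ‖e₀‖ = 1 := by simp [e₀]

theorem e₀_ne_zero : e₀ ≠ 0 := by
  intro h; have := norm_e₀; rw [h, norm_zero] at this; exact zero_ne_one this

/-- KNSS's **parasitic drift** `P(t, x) = (√(−t))⁻¹ e₀` (pressure `−½ (−t)^{−3/2} x₁`): spatially
constant, Type-I in time, NOT Type-I in space (KNSS 2009, §1 p. 3, "u(x,t) = b(t), p = −b′(t)·x").
Junk value `0` for `t ≥ 0`. [folklore] -/
def drift : ℝ → ℝ³ → ℝ³ := fun t _ => (Real.sqrt (-t))⁻¹ • e₀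

/-- The **kinematic Type-I cone field** `J(t, x) = (‖x‖ + √(−t))⁻¹ e₀`: every clause of the
antecedent except the PDE. [folklore] -/
def cone : ℝ → ℝ³ → ℝ³ := fun t x => (‖x‖ + Real.sqrt (-t))⁻¹ • e₀

/-- `√(−(2² t)) = 2 √(−t)` for every real `t` (both sides vanish for `t ≥ 0`). [folklore] -/
theorem sqrt_neg_four_mul (t : ℝ) : Real.sqrt (-((2 : ℝ) ^ 2 * t)) = 2 * Real.sqrt (-t) := by
  rw [show -((2 : ℝ) ^ 2 * t) = 2 ^ 2 * (-t) by ring, Real.sqrt_mul (by norm_num) (-t),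
    Real.sqrt_sq (by norm_num)]

/-- The drift is an ancient mild solution (duality form), by the in-tree
`isAncientMildSolution_timeConst` (every `t ↦ b(t)` is). [folklore] -/
theorem drift_isAncientMild : IsAncientMildSolution 1 drift :=
  isAncientMildSolution_timeConst 1 fun t => (Real.sqrt (-t))⁻¹ • e₀

/-- The drift is `(2, id)`-RDSS (indeed `(c, R)`-RDSS for every `c > 0` and every `R` fixing `e₀`).
[folklore] -/
theorem drift_isRotatedDSS : IsRotatedDSS 2 (LinearIsometryEquiv.refl ℝ ℝ³) drift := by
  intro t x
  simp only [drift, linearIsometryEquiv_refl_symm, LinearIsometryEquiv.coe_refl, id_eq, sqrt_neg_four_mul]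
  module

/-- The drift has measurable (constant) slices. [folklore] -/
theorem drift_measurable (t : ℝ) : AEStronglyMeasurable (drift t) (volume : Measure ℝ³) :=
  aestronglyMeasurable_const

/-- The drift obeys the Type-I bound IN TIME with constant `1` (equality). [folklore] -/
theorem drift_hasTypeITimeDecay : HasTypeITimeDecay 1 drift := by
  intro t ht x
  have hs : 0 < Real.sqrt (-t) := Real.sqrt_pos.2 (by linarith)
  simp only [drift, norm_smul, norm_inv, Real.norm_of_nonneg hs.le, norm_e₀, mul_one, one_div, le_refl]

/-- The drift is nonzero on the slice `t = −1` (indeed on every slice `t < 0`). [folklore] -/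
theorem drift_nontrivial : ¬ (∀ t < 0, drift t =ᵐ[volume] (0 : ℝ³ → ℝ³)) := by
  intro h
  have h1 := h (-1) (by norm_num)
  have heq : drift (-1) = 0 := (Continuous.ae_eq_iff_eq volume continuous_const continuous_const).1 h1
  have := congr_fun heq 0
  simp [drift, e₀_ne_zero] at this

/-- The drift is NOT Type-I in space: at `t = −1` its modulus is `1` everywhere while
`C₀/(‖x‖ + 1) → 0`. So it is NOT a witness of the actual antecedent. [folklore] -/
theorem drift_not_hasTypeIDecay (C₀ : ℝ) : ¬ HasTypeIDecay C₀ drift := by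
  intro h
  have key := h (-1) (by norm_num) ((|C₀| + 1) • e₀)
  have hn : ‖(|C₀| + 1) • e₀‖ = |C₀| + 1 := by
    rw [norm_smul, norm_e₀, mul_one, Real.norm_of_nonneg (by positivity)]
  simp only [drift, neg_neg, Real.sqrt_one, inv_one, one_smul, norm_e₀, hn] at key
  have hpos : 0 < |C₀| + 1 + 1 := by positivity
  rw [le_div_iff₀ hpos] at key
  linarith [le_abs_self C₀]

/-- The cone field is `(2, id)`-RDSS. [folklore] -/
theorem cone_isRotatedDSS : IsRotatedDSS 2 (LinearIsometryEquiv.refl ℝ ℝ³) cone := by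
  intro t x
  simp only [cone, linearIsometryEquiv_refl_symm, LinearIsometryEquiv.coe_refl, id_eq, sqrt_neg_four_mul,
    norm_smul, Real.norm_of_nonneg (show (0 : ℝ) ≤ 2 by norm_num), ← mul_add, mul_inv]
  module

/-- The cone field obeys the (space-time) Type-I bound with constant `1` (equality). [folklore] -/
theorem cone_hasTypeIDecay : HasTypeIDecay 1 cone := by
  intro t ht x
  have hden : 0 < ‖x‖ + Real.sqrt (-t) :=
    add_pos_of_nonneg_of_pos (norm_nonneg _) (Real.sqrt_pos.2 (by linarith))
  simp only [cone, norm_smul, norm_inv, Real.norm_of_nonneg hden.le, norm_e₀, mul_one, one_div, le_refl]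

/-- The cone field has continuous, hence measurable, slices for `t < 0`. [folklore] -/
theorem cone_measurable (t : ℝ) (ht : t < 0) : AEStronglyMeasurable (cone t) (volume : Measure ℝ³) := by
  have hden : ∀ x : ℝ³, ‖x‖ + Real.sqrt (-t) ≠ 0 := fun x =>
    (add_pos_of_nonneg_of_pos (norm_nonneg _) (Real.sqrt_pos.2 (by linarith))).ne'
  exact (((continuous_norm.add continuous_const).inv₀ hden).smul continuous_const).aestronglyMeasurable

/-- The cone field is nonzero on the slice `t = −1`. [folklore] -/
theorem cone_nontrivial : ¬ (∀ t < 0, cone t =ᵐ[volume] (0 : ℝ³ → ℝ³)) := by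
  intro h
  have h1 := h (-1) (by norm_num)
  have hcont : Continuous (cone (-1)) := by
    have hden : ∀ x : ℝ³, ‖x‖ + Real.sqrt (-(-1 : ℝ)) ≠ 0 := fun x =>
      (add_pos_of_nonneg_of_pos (norm_nonneg _) (Real.sqrt_pos.2 (by norm_num))).ne'
    exact ((continuous_norm.add continuous_const).inv₀ hden).smul continuous_const
  have heq : cone (-1) = 0 := (Continuous.ae_eq_iff_eq volume hcont continuous_const).1 h1
  have := congr_fun heq 0
  simp [cone, e₀_ne_zero] at this

/-! ### H = nontriviality -/

/-- The crux with the nontriviality clause deleted. [folklore] -/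
def CruxWithoutNontrivial : Prop :=
  (∃ (c : ℝ) (R : ℝ³ ≃ₗᵢ[ℝ] ℝ³) (u : ℝ → ℝ³ → ℝ³), 1 < c ∧ IsAncientMildSolution 1 u ∧
    (∀ t < 0, AEStronglyMeasurable (u t) volume) ∧ IsRotatedDSS c R u ∧
    (∃ C₀ : ℝ, HasTypeIDecay C₀ u)) → X5a

/-- `u ≡ 0` inhabits the antecedent minus nontriviality. [folklore] -/
theorem withoutNontrivial_inhabited :
    ∃ (c : ℝ) (R : ℝ³ ≃ₗᵢ[ℝ] ℝ³) (u : ℝ → ℝ³ → ℝ³), 1 < c ∧ IsAncientMildSolution 1 u ∧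
    (∀ t < 0, AEStronglyMeasurable (u t) volume) ∧ IsRotatedDSS c R u ∧
    (∃ C₀ : ℝ, HasTypeIDecay C₀ u) := by
  refine ⟨2, LinearIsometryEquiv.refl ℝ ℝ³, fun _ _ => 0, one_lt_two,
    isAncientMildSolution_timeConst 1 (fun _ => (0 : ℝ³)), fun t _ => aestronglyMeasurable_const,
    fun t x => by simp, ⟨0, fun t _ x => by simp⟩⟩

/-- Deleting nontriviality collapses the bridge to the blow-up problem itself. [folklore] -/
theorem cruxWithoutNontrivial_iff_x5a : CruxWithoutNontrivial ↔ X5a :=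
  ⟨fun h => h withoutNontrivial_inhabited, fun h _ => h⟩

/-! ### H = the PDE (`IsAncientMildSolution`) -/

/-- The crux with the ancient-mild-solution clause deleted. [folklore] -/
def CruxWithoutMild : Prop :=
  (∃ (c : ℝ) (R : ℝ³ ≃ₗᵢ[ℝ] ℝ³) (u : ℝ → ℝ³ → ℝ³), 1 < c ∧
    (∀ t < 0, AEStronglyMeasurable (u t) volume) ∧ IsRotatedDSS c R u ∧
    (∃ C₀ : ℝ, HasTypeIDecay C₀ u) ∧ ¬ (∀ t < 0, u t =ᵐ[volume] 0)) → X5a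

/-- The cone field inhabits the antecedent minus the PDE. [folklore] -/
theorem withoutMild_inhabited :
    ∃ (c : ℝ) (R : ℝ³ ≃ₗᵢ[ℝ] ℝ³) (u : ℝ → ℝ³ → ℝ³), 1 < c ∧
    (∀ t < 0, AEStronglyMeasurable (u t) volume) ∧ IsRotatedDSS c R u ∧
    (∃ C₀ : ℝ, HasTypeIDecay C₀ u) ∧ ¬ (∀ t < 0, u t =ᵐ[volume] 0) :=
  ⟨2, LinearIsometryEquiv.refl ℝ ℝ³, cone, one_lt_two, cone_measurable, cone_isRotatedDSS,
    ⟨1, cone_hasTypeIDecay⟩, cone_nontrivial⟩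

/-- Deleting the PDE collapses the bridge to the blow-up problem itself. [folklore] -/
theorem cruxWithoutMild_iff_x5a : CruxWithoutMild ↔ X5a :=
  ⟨fun h => h withoutMild_inhabited, fun h _ => h⟩

/-! ### H = the SPACE part of the Type-I bound -/

/-- The crux with `HasTypeIDecay` (`‖u‖ ≤ C₀/(‖x‖ + √(−t))`) weakened to `HasTypeITimeDecay`
(`‖u‖ ≤ C₀/√(−t)`). [folklore] -/
def CruxTimeDecayOnly : Prop :=
  (∃ (c : ℝ) (R : ℝ³ ≃ₗᵢ[ℝ] ℝ³) (u : ℝ → ℝ³ → ℝ³), 1 < c ∧ IsAncientMildSolution 1 u ∧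
    (∀ t < 0, AEStronglyMeasurable (u t) volume) ∧ IsRotatedDSS c R u ∧
    (∃ C₀ : ℝ, HasTypeITimeDecay C₀ u) ∧ ¬ (∀ t < 0, u t =ᵐ[volume] 0)) → X5a

/-- **The parasitic drift inhabits the time-decay-only antecedent** (machine-checked mutation: the
SPACE decay is the clause that keeps the duality-form profile class honest). [folklore] -/
theorem timeDecayOnly_inhabited :
    ∃ (c : ℝ) (R : ℝ³ ≃ₗᵢ[ℝ] ℝ³) (u : ℝ → ℝ³ → ℝ³), 1 < c ∧ IsAncientMildSolution 1 u ∧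
    (∀ t < 0, AEStronglyMeasurable (u t) volume) ∧ IsRotatedDSS c R u ∧
    (∃ C₀ : ℝ, HasTypeITimeDecay C₀ u) ∧ ¬ (∀ t < 0, u t =ᵐ[volume] 0) :=
  ⟨2, LinearIsometryEquiv.refl ℝ ℝ³, drift, one_lt_two, drift_isAncientMild, fun t _ => drift_measurable t,
    drift_isRotatedDSS, ⟨1, drift_hasTypeITimeDecay⟩, drift_nontrivial⟩

/-- Weakening Type-I to Type-I-in-time collapses the bridge to the blow-up problem. [folklore] -/
theorem cruxTimeDecayOnly_iff_x5a : CruxTimeDecayOnly ↔ X5a :=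
  ⟨fun h => h timeDecayOnly_inhabited, fun h _ => h⟩

/-- The time-decay-only bridge is STRONGER than the crux (space-time Type-I implies Type-I in time
for the positive constants that witnesses have). [folklore] -/
theorem crux_of_cruxTimeDecayOnly (h : CruxTimeDecayOnly) : RdssProfileTruncation := by
  rintro ⟨c, R, u, hc, hm, hmeas, hdss, ⟨C₀, hC⟩, hnz⟩
  exact h ⟨c, R, u, hc, hm, hmeas, hdss, ⟨C₀, hC.hasTypeITimeDecay (typeI_pos_of_witness hC hnz).le⟩, hnz⟩

/-- The crux with the Type-I clause deleted altogether. [folklore] -/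
def CruxWithoutTypeI : Prop :=
  (∃ (c : ℝ) (R : ℝ³ ≃ₗᵢ[ℝ] ℝ³) (u : ℝ → ℝ³ → ℝ³), 1 < c ∧ IsAncientMildSolution 1 u ∧
    (∀ t < 0, AEStronglyMeasurable (u t) volume) ∧ IsRotatedDSS c R u ∧
    ¬ (∀ t < 0, u t =ᵐ[volume] 0)) → X5a

/-- Deleting Type-I collapses the bridge to the blow-up problem (same drift witness; on paper also the
honest irrotational strain `u = (−t)⁻¹ A x`, `A` symmetric trace-free, see §e). [folklore] -/
theorem cruxWithoutTypeI_iff_x5a : CruxWithoutTypeI ↔ X5a :=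
  ⟨fun h => h ⟨2, LinearIsometryEquiv.refl ℝ ℝ³, drift, one_lt_two, drift_isAncientMild,
    fun t _ => drift_measurable t, drift_isRotatedDSS, drift_nontrivial⟩, fun h _ => h⟩

/-! ### H = the factor guard `1 < c` -/

/-- The crux with the guard `1 < c` deleted (any real factor allowed). [folklore] -/
def CruxWithoutFactorGuard : Prop :=
  (∃ (c : ℝ) (R : ℝ³ ≃ₗᵢ[ℝ] ℝ³) (u : ℝ → ℝ³ → ℝ³), IsAncientMildSolution 1 u ∧
    (∀ t < 0, AEStronglyMeasurable (u t) volume) ∧ IsRotatedDSS c R u ∧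
    (∃ C₀ : ℝ, HasTypeIDecay C₀ u) ∧ ¬ (∀ t < 0, u t =ᵐ[volume] 0)) → X5a

/-- A **nontrivial Type-I ancient mild solution** exists (no self-similarity): the failure of the
Liouville theorem for Type-I ancient mild solutions with measurable slices (open; under KNSS's
conjecture (L) it is false, in-tree `TypeIAncientLiouville`). [folklore] -/
def TypeIAncientWitness : Prop :=
  ∃ u : ℝ → ℝ³ → ℝ³, IsAncientMildSolution 1 u ∧ (∀ t < 0, AEStronglyMeasurable (u t) volume) ∧
    (∃ C₀ : ℝ, HasTypeIDecay C₀ u) ∧ ¬ (∀ t < 0, u t =ᵐ[volume] 0)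

/-- **Without the guard the bridge is the (stronger) Type-I-ancient bridge**: since `(1, id)`-RDSS is
void, the guard-free antecedent is just "a nontrivial Type-I ancient mild solution exists".
[folklore] -/
theorem cruxWithoutFactorGuard_iff : CruxWithoutFactorGuard ↔ (TypeIAncientWitness → X5a) := by
  constructor
  · rintro h ⟨u, hm, hmeas, hC, hnz⟩
    exact h ⟨1, LinearIsometryEquiv.refl ℝ ℝ³, u, hm, hmeas, isRotatedDSS_one_refl u, hC, hnz⟩
  · rintro h ⟨c, R, u, hm, hmeas, -, hC, hnz⟩
    exact h ⟨u, hm, hmeas, hC, hnz⟩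

/-- … and it implies the crux. [folklore] -/
theorem crux_of_cruxWithoutFactorGuard (h : CruxWithoutFactorGuard) : RdssProfileTruncation := by
  rintro ⟨c, R, u, -, hm, hmeas, hdss, hC, hnz⟩
  exact h ⟨c, R, u, hm, hmeas, hdss, hC, hnz⟩

/-- The antecedent with the guard replaced by `c ≠ 0 ∧ |c| ≠ 1` is EQUIVALENT to the original one
(negative factors: compose `R` with `−1`; factors in `(0,1)`: invert). So `1 < c` is a pure
normalisation except for `|c| = 1`, which is the class of `TypeIAncientWitness` (twisted by an
`R`-equivariance). [folklore] -/
theorem witness_iff_of_abs_ne_one :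
    (∃ (c : ℝ) (R : ℝ³ ≃ₗᵢ[ℝ] ℝ³) (u : ℝ → ℝ³ → ℝ³), c ≠ 0 ∧ |c| ≠ 1 ∧ IsAncientMildSolution 1 u ∧
      (∀ t < 0, AEStronglyMeasurable (u t) volume) ∧ IsRotatedDSS c R u ∧
      (∃ C₀ : ℝ, HasTypeIDecay C₀ u) ∧ ¬ (∀ t < 0, u t =ᵐ[volume] 0)) ↔ RdssWitness := by
  constructor
  · rintro ⟨c, R, u, hc0, hc1, hm, hmeas, hdss, hC, hnz⟩
    -- reduce to a positive factor
    obtain ⟨c', R', hc'0, hc'1, hdss'⟩ : ∃ (c' : ℝ) (R' : ℝ³ ≃ₗᵢ[ℝ] ℝ³), 0 < c' ∧ c' ≠ 1 ∧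
        IsRotatedDSS c' R' u := by
      rcases lt_or_gt_of_ne hc0 with hneg | hpos
      · exact ⟨-c, R.trans (LinearIsometryEquiv.neg ℝ), neg_pos.2 hneg,
          fun h1 => hc1 (by rw [abs_of_neg hneg, h1]), (isRotatedDSS_neg_iff c R u).2 hdss⟩
      · exact ⟨c, R, hpos, fun h1 => hc1 (by rw [abs_of_pos hpos, h1]), hdss⟩
    rcases lt_or_gt_of_ne hc'1 with hlt | hgt
    · refine ⟨c'⁻¹, R'.symm, u, one_lt_inv_iff₀.2 ⟨hc'0, hlt⟩, hm, hmeas, rdss_inv hdss' hc'0.ne', hC, hnz⟩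
    · exact ⟨c', R', u, hgt, hm, hmeas, hdss', hC, hnz⟩
  · rintro ⟨c, R, u, hc, hm, hmeas, hdss, hC, hnz⟩
    exact ⟨c, R, u, (one_pos.trans hc).ne', by rw [abs_of_pos (one_pos.trans hc)]; exact hc.ne', hm,
      hmeas, hdss, hC, hnz⟩

/-! ## §c Natural strengthenings

All strengthenings that keep the antecedent need an antecedent witness to be refuted, hence are as
unreachable as the crux; the reachable statements are the COLLAPSES of §a (each weakened-hypothesis
bridge is equivalent to `X5a`, hence at least as hard as proving blow-up outright) and the
implications `CruxTimeDecayOnly → crux`, `CruxWithoutFactorGuard → crux` above. -/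

/-! ## §d Targets (line `Sketch`, PICKED 2026-08-16T22:16Z) — pre-emptive, no stub registered yet

No stub is registered for this crux at this boundary (the lead's skeleton `Lines/Sketch.lean` is not
on the ledger).  Paper checks of the card's announced stubs, for the lead:

* `freePeriodMap_contracts` (zoom-out `w ↦ c⁻¹ (e^{(1−c⁻²)Δ} w)(·/c)` gains `c^{−2κ}` on the weight
  `(1+|y|)^{1−2κ}`, `0 < κ < 1/2`, `c ≥ 2`): TRUE in the three regimes `|x| ≤ 1` (gain
  `c⁻¹ ≤ c^{−2κ}`), `1 ≤ |x| ≤ c` (gain `|x|^{1−2κ} c⁻¹ ≤ c^{−2κ}`), `|x| ≥ c` (exact `c^{−2κ}`);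
  the heat flow at times `≤ 1` is bounded on the slowly varying weight.  No attack.
* Compactness of the Duhamel part on `X`: tight at infinity because `|U| ≤ C₀/(1+|y|)` gives the
  image an extra factor `(1+|y|)⁻¹` in the `X`-weight; locally equicontinuous by parabolic smoothing.
  Plausible; the SPACE decay of the profile is used exactly here (cf. `cruxTimeDecayOnly_iff_x5a`).
* The fixed-point identity `𝓡(U) = U` needs FORWARD UNIQUENESS over one period from the slice
  `U = u(−1)` in a class containing the given duality-form solution `u`.  In the bare duality-form
  class forward uniqueness FAILS (KNSS's Galilean drifts `u(x − B(t), t) + B′(t)`, `B(−1) = B′(−1) = 0`;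
  in-tree `UniformDriftBackwardNonuniqueness`, `KNSSRegularityGalilean`, and the drift of
  `timeDecayOnly_inhabited` above); it is restored only by the spatial Type-I decay (frame pinning,
  `u → 0` at infinity) — a second place where any proof must consume `C₀/(‖x‖ + √(−t))` and not the
  rate alone.  The card's phase space `X` (fields vanishing at infinity) is consistent with this.
* Nontriviality AT `t = −1`: the antecedent only gives some nonzero slice `t₀ < 0`; the lead's plan
  (rescale `u` so that `t₀ ↦ −1`) uses scale invariance of the hypothesis class, i.e. the named fact
  `IsAncientMildSolution.nsRescale` / `IsMildNSSolutionBetween.nsRescale` of `SelfSimilar.lean`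
  (discharge status decides conditionality) — `HasTypeIDecay.nsRescale` is proved there, and
  `(c,R)`-RDSS is `nsRescale`-invariant when `R` commutes with dilations (always). -/

/-! ## §e Near-misses and open ends (not claimed)

* *Measurability.*  Without `∀ t < 0, AEStronglyMeasurable (u t)`, a sign pattern
  `σ(x) (‖x‖+√(−t))⁻¹ e₀`, `σ = ±1` on a `(cR)`-invariant nowhere-locally-null-measurable set, makes
  the two LINEAR pairings of the duality identity Bochner-junk (`= 0`) but leaves the QUADRATIC term
  `∫⟪u, (u·∇)ψ⟫ = ∫ (‖x‖+√(−τ))⁻² ∂₀ψ₀` honest and nonzero for generic tests, so the identity fails;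
  direction patterns `v(x) ∈ {e₀, e₁}` fail on the `e₀ ↔ e₁`-symmetric tests, where all terms are
  honest and the modulus `(‖x‖+√(−t))⁻¹` would have to be caloric.  No junk inhabitant of the
  measurability-free antecedent is known; Mathlib has no non-measurable set to build one from anyway.
* *Honest Type-I-free witnesses.*  The irrotational strain `u = (−t)⁻¹ A x`, `A` symmetric,
  `tr A = 0` (pressure `−½ xᵀ(A + A²)x/t²`) is a smooth exact ancient solution, DSS for every factor,
  invisible to divergence-free tests (a harmonic gradient), not Type-I; its membership in
  `IsAncientMildSolution` needs the classical ⇒ mild computation for polynomially growing fields,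
  which the tree only has for bounded fields (`IsClassicalNSSolutionOn.isMildNSSolutionOn`).  Not
  needed: the drift already witnesses `CruxWithoutTypeI ↔ X5a`.
-/

end Summit.NavierStokesRegularity.NavierStokesRegularity.Cruxes.RdssProfileTruncation.Disproof
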